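import Literature.AlgebraicGeometry.Motives.WeilFormOrthogonalFrame
import Literature.AlgebraicGeometry.Motives.WeilFormComplexifiedFrame
import Literature.AlgebraicGeometry.Motives.WeilFormIsotropicBlockVectors
import Literature.AlgebraicGeometry.Motives.WeilOperatorModule
import HarnessLib

/-!
# The signature `(n, n)` of the rational model of a Weil pair from Hodge–Riemann data in coordinates

Family `hodge`, layer `Literature/AlgebraicGeometry/Motives`. B. van Geemen, *An introduction to the
Hodge conjecture for abelian varieties*, LNM 1594 (1994), Lemma 5.2 (4): "The signature of the
Hermitian form `H` is `(n, n)`", proved there (p. 221) from the second Riemann condition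
`E(x, Jx) > 0` and the eigenspaces `W_±` of `(√-d)_*` on `T₀X`: "restricted to `W_±` we have
`H(x, x) = E(x, √-d x) = ± √d E(x, Jx)` … `H` is positive definite on `W₊` (and negative definite
on `W₋`)". This file proves the statement in the COORDINATE form consumed by the Hodge summit
(route `HeckePrymWeil`, the rational degree-one model `(M, G)` of `(A, φ, h)`: `M² = -d` the matrix
of `φ^*` in a rational basis of `H¹(A(ℂ); ℂ)`, `G` the alternating Gram matrix of
`Q_h = h^{dim A - 1} ∪ · ∪ ·`, `Mᵀ G M = d G`), WITHOUT a complex structure `J`: the transcendental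
input is packaged as `n'`-dimensional subspaces `T₊ ⊆ V_{i√d}(M_ℂ)`, `T₋ ⊆ V_{-i√d}(M_ℂ)` of `ℂ^{4n'}`
on which the Hermitian form `i · x G_ℂ x̄` has one fixed sign `ε` (in the application: the
`(1,0)`-parts of the two eigenspaces of `φ^*`, Hodge–Riemann in degree one, Voisin I Thm. 6.32).

* `exists_posNeg_of_coordHodgeRiemann` — **then `ℚ^{4n'} ⊇ P ⊕ N` with `M`-stable `P`, `N` of
  dimension `2n'`, `P ⊓ N = 0`, and `x ↦ x · G M x` positive definite on `P`, negative definite on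
  `N`.** Proof: an orthogonal `K`-frame `e₁, …, e_{2n'}` for van Geemen's Hermitian form
  (`exists_weil_orthogonalFrame`, `K = ℚ(√-d)` acting through `M`, `Motives/WeilOperatorModule`);
  the complexified eigenvectors `f_j^± = (M e_j)_ℂ ± i√d (e_j)_ℂ` with
  `f_j · (G M)_ℂ f̄_l = δ_{jl} · 2 d Q(e_j)` (`frameVec_pairing`); the count
  `card_filter_nonpos_le_of_definite` in `V_{-i√d}` (with `T₋`, sign `ε`) and in `V_{i√d}` (with
  `T₊`, sign `-ε`) gives `#{j : ε Q(e_j) > 0} ≥ n'` and `#{j : ε Q(e_j) < 0} ≥ n'`, hence both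
  `= n'`; then `P = span_K {e_j : Q(e_j) > 0}`, `N = span_K {e_j : Q(e_j) < 0}`
  (`weilQ_pos_of_mem_span`).
* `le_card_filter_pos_of_card_filter_nonpos_le`, `card_eq_of_disjoint_of_le` — counting helpers.

Everything is proved; no definition and no named fact is introduced.

## References

* [vanGeemen1994HodgeAV] B. van Geemen, LNM 1594 (1994), Lemma 5.2 (2), (4), (5) with proof.
* [VoisinHodgeI2002] C. Voisin, Hodge Theory and Complex Algebraic Geometry I (2002), Thm. 6.32.
-/

noncomputable section

open Module
open scoped Matrix ComplexConjugate

namespace Literature.AlgebraicGeometry.Motives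

section CoordSignature

/-- `#{j | s qⱼ ≤ 0} ≤ n'` among `2n'` indices gives `n' ≤ #{j | 0 < s qⱼ}`. [folklore] -/
theorem le_card_filter_pos_of_card_filter_nonpos_le {m n' : ℕ} (hm : m = 2 * n') (q : Fin m → ℚ)
    (s : ℚ) (h : (Finset.univ.filter fun j => s * q j ≤ 0).card ≤ n') :
    n' ≤ (Finset.univ.filter fun j => 0 < s * q j).card := by
  have h2 := Finset.card_filter_add_card_filter_not (s := Finset.univ)
    (p := fun j : Fin m => s * q j ≤ 0)
  simp only [not_le, Finset.card_univ, Fintype.card_fin] at h2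
  omega

/-- Two disjoint index sets of size `≥ n'` among `2n'` indices both have size `n'`. [folklore] -/
theorem card_eq_of_disjoint_of_le {m n' : ℕ} (hm : m = 2 * n') (A B : Finset (Fin m))
    (hAB : Disjoint A B) (hA : n' ≤ A.card) (hB : n' ≤ B.card) : A.card = n' ∧ B.card = n' := by
  have h := Finset.card_union_of_disjoint hAB
  have h2 : (A ∪ B).card ≤ m := by
    have := Finset.card_le_univ (A ∪ B)
    rwa [Fintype.card_fin] at this
  omega


/-- **The signature `(n', n')` of the rational model from coordinate Hodge–Riemann data.**
Let `M² = -d` (`d > 0`), `G` alternating with `Mᵀ G M = d G` on `ℚ^{4n'}`, and suppose the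
complexification carries `n'`-dimensional subspaces `T₊ ⊆ V_{i√d}(M_ℂ)`, `T₋ ⊆ V_{-i√d}(M_ℂ)` on
which the Hermitian form `i · x G x̄` has a fixed sign `ε` (Hodge–Riemann in degree one on
`H^{1,0} ∩ V_±`). Then `ℚ^{4n'} = P ⊕ N ⊕ …` with `M`-stable `P`, `N` of dimension `2n'`,
`P ⊓ N = 0`, and `x ↦ x · G M x` positive definite on `P`, negative definite on `N`
(van Geemen, LNM 1594, Lemma 5.2 (4): the Hermitian form `H` has signature `(n', n')`). [cite: vanGeemen1994HodgeAV, Lemma 5.2 (4)–(5) and proof] -/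
theorem exists_posNeg_of_coordHodgeRiemann {n' : ℕ} (M G : Matrix (Fin (4 * n')) (Fin (4 * n')) ℚ)
    {d : ℚ} (hd : 0 < d) (hM2 : ∀ v, M *ᵥ (M *ᵥ v) = -(d • v))
    (hGt : ∀ x y : Fin (4 * n') → ℚ, y ⬝ᵥ G *ᵥ x = -(x ⬝ᵥ G *ᵥ y))
    (hW : ∀ x y : Fin (4 * n') → ℚ, M *ᵥ x ⬝ᵥ G *ᵥ (M *ᵥ y) = d * (x ⬝ᵥ G *ᵥ y))
    (Tp Tm : Submodule ℂ (Fin (4 * n') → ℂ))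
    (hTp : ∀ x ∈ Tp, M.map (Rat.castHom ℂ) *ᵥ x = (Complex.I * (Real.sqrt d : ℂ)) • x)
    (hTm : ∀ x ∈ Tm, M.map (Rat.castHom ℂ) *ᵥ x = (-(Complex.I * (Real.sqrt d : ℂ))) • x)
    (hTpn : finrank ℂ Tp = n') (hTmn : finrank ℂ Tm = n') (ε : ℚ) (hε : ε = 1 ∨ ε = -1)
    (hposp : ∀ x ∈ Tp, x ≠ 0 → 0 < (ε : ℝ) * (Complex.I * (x ⬝ᵥ G.map (Rat.castHom ℂ) *ᵥ star x)).re)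
    (hposm : ∀ x ∈ Tm, x ≠ 0 → 0 < (ε : ℝ) * (Complex.I * (x ⬝ᵥ G.map (Rat.castHom ℂ) *ᵥ star x)).re) :
    ∃ P Nn : Submodule ℚ (Fin (4 * n') → ℚ),
      (∀ v ∈ P, M *ᵥ v ∈ P) ∧ (∀ v ∈ Nn, M *ᵥ v ∈ Nn) ∧
      finrank ℚ P = 2 * n' ∧ finrank ℚ Nn = 2 * n' ∧ P ⊓ Nn = ⊥ ∧
      (∀ x ∈ P, x ≠ 0 → 0 < x ⬝ᵥ G *ᵥ (M *ᵥ x)) ∧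
      (∀ x ∈ Nn, x ≠ 0 → x ⬝ᵥ G *ᵥ (M *ᵥ x) < 0) := by
  classical
  -- the `K`-structure on `V = ℚ^{4n'}`
  obtain ⟨K, _, _, α, hα, hK⟩ := Literature.AlgebraicGeometry.Motives.exists_quadraticField d hd
  haveI : Module.Finite ℚ K := Module.Finite.of_basis (basisOneAlpha hd hα hK)
  obtain ⟨inst, hinst⟩ := exists_module_smul_eq (V := Fin (4 * n') → ℚ) hd hα hK (Matrix.mulVecLin M)
    (fun v => by rw [Matrix.mulVecLin_apply, Matrix.mulVecLin_apply]; exact hM2 v)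
  letI : Module K (Fin (4 * n') → ℚ) := inst
  haveI : IsScalarTower ℚ K (Fin (4 * n') → ℚ) := hinst.1
  have hαM : ∀ v : Fin (4 * n') → ℚ, α • v = M *ᵥ v := fun v => by
    rw [hinst.2 v, Matrix.mulVecLin_apply]
  haveI : Module.Finite K (Fin (4 * n') → ℚ) := Module.Finite.of_restrictScalars_finite ℚ K _
  have hV : finrank K (Fin (4 * n') → ℚ) = 2 * n' := by
    have h := two_mul_finrank_eq_of_weilOperator (V := Fin (4 * n') → ℚ) hd hα hK
    rw [Module.finrank_fintype_fun_eq_card, Fintype.card_fin] at h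
    omega
  set E : LinearMap.BilinForm ℚ (Fin (4 * n') → ℚ) := Matrix.toBilin' G with hEdef
  have hEapp : ∀ x y : Fin (4 * n') → ℚ, E x y = x ⬝ᵥ G *ᵥ y := fun x y => Matrix.toBilin'_apply' G x y
  have hE : ∀ x y : Fin (4 * n') → ℚ, E x y = -E y x := fun x y => by rw [hEapp, hEapp, hGt]
  have hWE : ∀ x y : Fin (4 * n') → ℚ, E (α • x) (α • y) = d * E x y := fun x y => by
    rw [hEapp, hEapp, hαM, hαM, hW]
  have hEQ : ∀ x : Fin (4 * n') → ℚ, E x (α • x) = x ⬝ᵥ G *ᵥ (M *ᵥ x) := fun x => by rw [hEapp, hαM]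
  have hE0 : ∀ x : Fin (4 * n') → ℚ, x ⬝ᵥ G *ᵥ x = 0 := fun x => by
    have h := hGt x x
    linarith
  -- an orthogonal `K`-frame
  obtain ⟨e, he, horth⟩ := exists_weil_orthogonalFrame hd hα hK (2 * n') (Fin (4 * n') → ℚ) hV E hE hWE
  set Qv : Fin (2 * n') → ℚ := fun j => E (e j) (α • e j) with hQv
  -- complexification of the frame
  have hb : LinearIndependent ℚ (Sum.elim e fun j => M *ᵥ e j) := by
    have h := linearIndependent_sumElim_smul hd hα he
    have heq : (Sum.elim e fun j => α • e j) = Sum.elim e fun j => M *ᵥ e j := by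
      funext x
      rcases x with j | j
      · rfl
      · exact hαM (e j)
    rwa [heq] at h
  have hbc : LinearIndependent ℂ fun x => ((Rat.castHom ℂ) ∘ Sum.elim e (fun j => M *ᵥ e j) x : Fin (4 * n') → ℂ) :=
    linearIndependent_ratCast_comp hb (by rw [Fintype.card_sum, Fintype.card_fin]; ring)
  -- the eigenvalues `± i√d`
  set μ₀ : ℂ := Complex.I * (Real.sqrt d : ℂ) with hμ₀
  have hsd : 0 < Real.sqrt d := Real.sqrt_pos.2 (by exact_mod_cast hd)
  have hsq : ((Real.sqrt d : ℝ) : ℂ) * (Real.sqrt d : ℂ) = ((d : ℚ) : ℂ) := by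
    rw [← Complex.ofReal_mul, Real.mul_self_sqrt (by exact_mod_cast hd.le), Complex.ofReal_ratCast]
  have hμ₀sq : μ₀ * μ₀ = -((d : ℚ) : ℂ) := by
    rw [hμ₀, ← hsq]
    linear_combination ((Real.sqrt d : ℝ) : ℂ) * (Real.sqrt d : ℂ) * Complex.I_mul_I
  have hμ₀sq' : (-μ₀) * (-μ₀) = -((d : ℚ) : ℂ) := by rw [neg_mul_neg, hμ₀sq]
  have hμ₀s : star μ₀ = -μ₀ := by
    rw [hμ₀, Complex.star_def, map_mul, Complex.conj_I, Complex.conj_ofReal, neg_mul]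
  have hμ₀s' : star (-μ₀) = -(-μ₀) := by rw [star_neg, hμ₀s]
  have hμ₀ne : μ₀ ≠ 0 := mul_ne_zero Complex.I_ne_zero (by exact_mod_cast hsd.ne')
  -- the eigenvector families `f±`
  set T : Module.End ℂ (Fin (4 * n') → ℂ) := Matrix.toLin' (M.map (Rat.castHom ℂ)) with hT
  have hfeig : ∀ μ : ℂ, μ * μ = -((d : ℚ) : ℂ) → ∀ j,
      T (((Rat.castHom ℂ) ∘ (M *ᵥ e j) : Fin (4 * n') → ℂ) + μ • ((Rat.castHom ℂ) ∘ e j)) =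
        μ • (((Rat.castHom ℂ) ∘ (M *ᵥ e j) : Fin (4 * n') → ℂ) + μ • ((Rat.castHom ℂ) ∘ e j)) := fun μ hμ j => by
    rw [hT, Matrix.toLin'_apply]
    exact map_mulVec_frameVec M hM2 hμ (e j)
  have hfind : ∀ μ : ℂ, LinearIndependent ℂ fun j =>
      (((Rat.castHom ℂ) ∘ (M *ᵥ e j) : Fin (4 * n') → ℂ) + μ • ((Rat.castHom ℂ) ∘ e j)) := fun μ =>
    linearIndependent_frameVec M e hbc μ
  have hfval : ∀ μ : ℂ, μ * μ = -((d : ℚ) : ℂ) → star μ = -μ → ∀ j l,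
      (((Rat.castHom ℂ) ∘ (M *ᵥ e j) : Fin (4 * n') → ℂ) + μ • ((Rat.castHom ℂ) ∘ e j)) ⬝ᵥ (G.map (Rat.castHom ℂ) * M.map (Rat.castHom ℂ)) *ᵥ
        star (((Rat.castHom ℂ) ∘ (M *ᵥ e l) : Fin (4 * n') → ℂ) + μ • ((Rat.castHom ℂ) ∘ e l)) =
      if j = l then (((2 * d * Qv j : ℚ) : ℝ) : ℂ) else 0 := fun μ hμ hμs j l => by
    rw [frameVec_pairing M G hM2 hW hμ hμs]
    split_ifs with hjl
    · subst hjl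
      rw [hE0, mul_zero, Rat.cast_zero, mul_zero, sub_zero, Complex.ofReal_ratCast]
      simp only [hQv, hEQ]
    · obtain ⟨h1, h2⟩ := apply_eq_zero_and_of_weilHermitianForm_eq_zero E hd hα (horth j l hjl)
      rw [hEapp, hαM] at h1
      rw [hEapp] at h2
      rw [h1, h2]
      simp
  -- dimension bounds for the eigenspaces
  have hVp : finrank ℂ (Module.End.eigenspace T μ₀) ≤ 2 * n' :=
    finrank_eigenspace_le_of_linearIndependent_neg rfl T hμ₀ne _ (hfind (-μ₀)) (hfeig (-μ₀) hμ₀sq')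
  have hVm : finrank ℂ (Module.End.eigenspace T (-μ₀)) ≤ 2 * n' :=
    finrank_eigenspace_le_of_linearIndependent_neg rfl T (neg_ne_zero.2 hμ₀ne) _ (hfind μ₀)
      (fun j => by rw [neg_neg]; exact hfeig μ₀ hμ₀sq j)
  have hTp_le : Tp ≤ Module.End.eigenspace T μ₀ := fun x hx =>
    Module.End.mem_eigenspace_iff.2 (by rw [hT, Matrix.toLin'_apply]; exact hTp x hx)
  have hTm_le : Tm ≤ Module.End.eigenspace T (-μ₀) := fun x hx =>
    Module.End.mem_eigenspace_iff.2 (by rw [hT, Matrix.toLin'_apply]; exact hTm x hx)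
  -- the Hermitian form `x · (G M)_ℂ x̄` on `T±`
  have hSm : ∀ x ∈ Tm, x ≠ 0 → 0 < (ε : ℝ) * (x ⬝ᵥ (G.map (Rat.castHom ℂ) * M.map (Rat.castHom ℂ)) *ᵥ star x).re := by
    intro x hx hx0
    have h1 : x ⬝ᵥ (G.map (Rat.castHom ℂ) * M.map (Rat.castHom ℂ)) *ᵥ star x =
        ((Real.sqrt d : ℝ) : ℂ) * (Complex.I * (x ⬝ᵥ G.map (Rat.castHom ℂ) *ᵥ star x)) := by
      rw [← Matrix.mulVec_mulVec, map_ratCast_mulVec_star, hTm x hx, star_smul, hμ₀s', neg_neg,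
        Matrix.mulVec_smul, dotProduct_smul, smul_eq_mul, hμ₀]
      ring
    rw [h1, Complex.re_ofReal_mul, mul_left_comm]
    exact mul_pos hsd (hposm x hx hx0)
  have hSp : ∀ x ∈ Tp, x ≠ 0 → 0 < ((-ε : ℚ) : ℝ) * (x ⬝ᵥ (G.map (Rat.castHom ℂ) * M.map (Rat.castHom ℂ)) *ᵥ star x).re := by
    intro x hx hx0
    have h1 : x ⬝ᵥ (G.map (Rat.castHom ℂ) * M.map (Rat.castHom ℂ)) *ᵥ star x =
        -(((Real.sqrt d : ℝ) : ℂ) * (Complex.I * (x ⬝ᵥ G.map (Rat.castHom ℂ) *ᵥ star x))) := by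
      rw [← Matrix.mulVec_mulVec, map_ratCast_mulVec_star, hTp x hx, star_smul, hμ₀s,
        Matrix.mulVec_smul, dotProduct_smul, smul_eq_mul, hμ₀]
      ring
    rw [h1, Complex.neg_re, Complex.re_ofReal_mul]
    have h := mul_pos hsd (hposp x hx hx0)
    push_cast
    nlinarith
  -- the two counts
  have cm := card_filter_nonpos_le_of_definite T (G.map (Rat.castHom ℂ) * M.map (Rat.castHom ℂ)) _ (hfind (-μ₀)) (hfeig (-μ₀) hμ₀sq') hd Qv
    (hfval (-μ₀) hμ₀sq' hμ₀s') hVm ε Tm hTm_le hTmn hSm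
  have cp := card_filter_nonpos_le_of_definite T (G.map (Rat.castHom ℂ) * M.map (Rat.castHom ℂ)) _ (hfind μ₀) (hfeig μ₀ hμ₀sq) hd Qv
    (hfval μ₀ hμ₀sq hμ₀s) hVp (-ε) Tp hTp_le hTpn hSp
  have cm' := le_card_filter_pos_of_card_filter_nonpos_le rfl Qv ε cm
  have cp' := le_card_filter_pos_of_card_filter_nonpos_le rfl Qv (-ε) cp
  -- `#{Q > 0} = #{Q < 0} = n'`
  have hcard : (Finset.univ.filter fun j => 0 < Qv j).card = n' ∧
      (Finset.univ.filter fun j => Qv j < 0).card = n' := by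
    have hdis : Disjoint (Finset.univ.filter fun j => 0 < Qv j) (Finset.univ.filter fun j => Qv j < 0) :=
      Finset.disjoint_filter.2 fun j _ h1 h2 => lt_asymm h1 h2
    rcases hε with rfl | rfl
    · simp only [one_mul] at cm'
      simp only [neg_mul, one_mul, Left.neg_pos_iff] at cp'
      exact card_eq_of_disjoint_of_le rfl _ _ hdis cm' cp'
    · simp only [neg_mul, one_mul, Left.neg_pos_iff] at cm'
      simp only [neg_neg, one_mul] at cp'
      exact card_eq_of_disjoint_of_le rfl _ _ hdis cp' cm'
  -- the definite subspaces
  set Pk : Submodule K (Fin (4 * n') → ℚ) :=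
    Submodule.span K (Set.range fun j : {j // 0 < Qv j} => e j) with hPk
  set Nk : Submodule K (Fin (4 * n') → ℚ) :=
    Submodule.span K (Set.range fun j : {j // Qv j < 0} => e j) with hNk
  have hPi : LinearIndependent K fun j : {j // 0 < Qv j} => e j :=
    he.comp (fun j : {j // 0 < Qv j} => (j : Fin (2 * n'))) Subtype.val_injective
  have hNi : LinearIndependent K fun j : {j // Qv j < 0} => e j :=
    he.comp (fun j : {j // Qv j < 0} => (j : Fin (2 * n'))) Subtype.val_injective
  have hPr : finrank ℚ (Pk.restrictScalars ℚ) = 2 * n' := by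
    rw [← two_mul_finrank_submodule_eq (V := Fin (4 * n') → ℚ) hd hα hK Pk, hPk,
      finrank_span_eq_card hPi, Fintype.card_subtype, hcard.1]
  have hNr : finrank ℚ (Nk.restrictScalars ℚ) = 2 * n' := by
    rw [← two_mul_finrank_submodule_eq (V := Fin (4 * n') → ℚ) hd hα hK Nk, hNk,
      finrank_span_eq_card hNi, Fintype.card_subtype, hcard.2]
  have hdisj : Pk ⊓ Nk = ⊥ := by
    have h := he.disjoint_span_image (s := {j | 0 < Qv j}) (t := {j | Qv j < 0})
      (Set.disjoint_left.2 fun j h1 h2 =>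
        lt_asymm (show 0 < Qv j from h1) (show Qv j < 0 from h2))
    have e1 : e '' {j | 0 < Qv j} = Set.range fun j : {j // 0 < Qv j} => e j :=
      Set.ext fun x => ⟨fun ⟨j, hj, hx⟩ => ⟨⟨j, hj⟩, hx⟩, fun ⟨j, hx⟩ => ⟨j, j.2, hx⟩⟩
    have e2 : e '' {j | Qv j < 0} = Set.range fun j : {j // Qv j < 0} => e j :=
      Set.ext fun x => ⟨fun ⟨j, hj, hx⟩ => ⟨⟨j, hj⟩, hx⟩, fun ⟨j, hx⟩ => ⟨j, j.2, hx⟩⟩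
    rw [e1, e2] at h
    exact disjoint_iff.1 h
  have horthP : ∀ j l : {j // 0 < Qv j}, j ≠ l → weilHermitianForm E α (e j) (e l) = 0 :=
    fun j l hjl => horth j l fun h => hjl (Subtype.ext h)
  have horthN : ∀ j l : {j // Qv j < 0}, j ≠ l → weilHermitianForm E α (e j) (e l) = 0 :=
    fun j l hjl => horth j l fun h => hjl (Subtype.ext h)
  refine ⟨Pk.restrictScalars ℚ, Nk.restrictScalars ℚ, ?_, ?_, hPr, hNr, ?_, ?_, ?_⟩
  · intro v hv
    change M *ᵥ v ∈ Pk
    rw [← hαM]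
    exact Pk.smul_mem α hv
  · intro v hv
    change M *ᵥ v ∈ Nk
    rw [← hαM]
    exact Nk.smul_mem α hv
  · rw [Submodule.eq_bot_iff]
    rintro x ⟨hxP, hxN⟩
    have hx : x ∈ Pk ⊓ Nk := ⟨hxP, hxN⟩
    rw [hdisj] at hx
    exact (Submodule.mem_bot K).1 hx
  · intro x hx hx0
    have h := weilQ_pos_of_mem_span E hd hα hK hE hWE _ horthP 1
      (fun j => by rw [one_mul]; exact j.2) hx hx0
    rwa [one_mul, hEQ] at h
  · intro x hx hx0
    have h := weilQ_pos_of_mem_span E hd hα hK hE hWE _ horthN (-1)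
      (fun j => by have := j.2; linarith) hx hx0
    rw [hEQ] at h
    linarith

end CoordSignature

end Literature.AlgebraicGeometry.Motives

end
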